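import Summits.ABC.ABC.Theses.DefiniteXi
import Summits.ABC.ABC.Theorems.DefiniteXiFreyModularity
import HarnessLib

/-!
# Transport of modular parametrisation data along a change of variables, with the degree

Stub `stub_smulTransportDeg` of the line `Sketch` (card `optimal-pivot-spine`, crux stmt-ABC-11338
`DefiniteXi.DefiniteRTControlPrime`): a modular parametrisation datum `D` of `C • W` at level `N`
(`C = (u, r, s, t)` an admissible change of variables over `ℚ`, `u = p/q` in lowest terms) yields a
datum `D'` of `W` at level `N` with the SAME newform `D'.f = D.f` and the CONTROLLED degree
`D'.deg = p² · D.deg`.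

This is the construction of the tree's
`Summit.ABC.ABC.Theorems.nonempty_modularParametrizationData_of_smul`
(`Summits/ABC/ABC/Theorems/DefiniteXiFreyModularity.lean`), whose statement forgets the newform
and the degree; the proof below is that construction verbatim with the two equalities exposed
(Silverman AEC III.1 Table 3.1, VI.5; Cremona §2.10): the new datum has newform `f`
(`L(C • W, s) = L(W, s)`, `WeierstrassCurve.LFunction_smul`), lattice `u⁻¹Λ'`
(`ω_W = u⁻¹ ω_{C • W}`), uniformisation `z ↦ ι⁻¹(ψ'(uz))` through the substitution
`ι : W(ℂ) ≃ (C • W)(ℂ)` on points (`VariableChange.pointEquivBaseChange`), Manin constant `q c'`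
(`u (q c') Λ_f = p c' Λ_f ⊆ p Λ' ⊆ Λ'`) and degree `p² d'`: the new parametrisation is
`ι⁻¹ ∘ [p] ∘ φ'`, and every fibre of `[p]` on `(C • W)(ℂ) ≅ ℂ/Λ'` has exactly `p²` points
(`finite_setOf_natCard_fibre_zsmul_ne`, from `WeierstrassCurve.card_torsionBy_eq_sq`,
Silverman AEC III.6.4(b)).
-/

-- `Summit.<Summit>.<Problem>` is the mandated summit-side namespace (CONVENTIONS §2); for the
-- single-conjunct summit `ABC` the two coincide, so the duplicate `ABC.ABC` is deliberate.
set_option linter.dupNamespace false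

noncomputable section

open scoped MatrixGroups ModularForm

open CongruenceSubgroup UpperHalfPlane Complex
open Literature.NumberTheory.EllipticCurves
open Literature.NumberTheory.EllipticCurves.ModularForms
open WeierstrassCurve

namespace Summit.ABC.ABC.Theorems.DefiniteRTControlPrime

/-- **Transport of modular parametrisation data along a change of variables, with the degree.**
If `D` is a modular parametrisation datum of `C • W` at level `N` (`C = (u, r, s, t)` an admissible
change of variables over `ℚ`, `u = p/q` in lowest terms), then `W` carries a datum `D'` at level
`N` with the same newform, `D'.f = D.f` (`L(C • W, s) = L(W, s)`), and degree
`D'.deg = p² · D.deg` (`p = |num u|`): lattice `u⁻¹Λ'` (`ω_W = u⁻¹ω_{C • W}`, Silverman AEC III.1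
Table 3.1), uniformisation `z ↦ ι⁻¹(ψ'(uz))` through the substitution `ι : W(ℂ) ≃ (C • W)(ℂ)` on
points, Manin constant `q c'`; the new parametrisation is `ι⁻¹ ∘ [p] ∘ φ'`, and `[p]` has fibres
of `p²` points on `(C • W)(ℂ)` (the tree's `nonempty_modularParametrizationData_of_smul` with the
newform and the degree exposed). [cite: SilvermanAEC2009, III.1 Table 3.1 and Cor. III.6.4(b)] -/
theorem stub_smulTransportDeg {W : WeierstrassCurve ℚ} [W.IsElliptic] (C : VariableChange ℚ)
    {N : ℕ} [NeZero N] (D : ModularParametrizationData (C • W) N) :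
    ∃ D' : ModularParametrizationData W N,
      D'.f = D.f ∧ D'.deg = (C.u : ℚ).num.natAbs ^ 2 * D.deg := by
  -- notation
  set u : ℚ := (C.u : ℚ) with hu_def
  have hu : u ≠ 0 := C.u.ne_zero
  have huC : (u : ℂ) ≠ 0 := by exact_mod_cast hu
  have huCi : (u : ℂ)⁻¹ ≠ 0 := inv_ne_zero huC
  set Cc : WeierstrassCurve.VariableChange ℂ := C.map (algebraMap ℚ ℂ) with hCc_def
  have hCcu : ((Cc.u : ℂˣ) : ℂ) = (u : ℂ) := by
    simp [hCc_def, WeierstrassCurve.VariableChange.map_u, hu_def]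
  have hCcui : ((Cc.u⁻¹ : ℂˣ) : ℂ) = (u : ℂ)⁻¹ := by
    rw [Units.val_inv_eq_inv_val, hCcu]
  have hCcr : Cc.r = (C.r : ℂ) := by simp [hCc_def]
  have hCcs : Cc.s = (C.s : ℂ) := by simp [hCc_def]
  have hCct : Cc.t = (C.t : ℂ) := by simp [hCc_def]
  have hsmul : (C • W).baseChange ℂ = Cc • W.baseChange ℂ :=
    WeierstrassCurve.VariableChange.baseChange_smul_eq W C ℂ
  -- the substitution on points
  set ι : (W.baseChange ℂ).toAffine.Point ≃+ ((C • W).baseChange ℂ).toAffine.Point :=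
    WeierstrassCurve.VariableChange.pointEquivBaseChange W C ℂ with hι_def
  -- the lattice `u⁻¹ Λ'`
  set L : PeriodPair := D.L.mulLeft (u : ℂ)⁻¹ huCi with hL_def
  have hmemL : ∀ z : ℂ, z ∈ L.lattice ↔ (u : ℂ) * z ∈ D.L.lattice := fun z ↦ by
    rw [hL_def, PeriodPair.mem_mulLeft_lattice, inv_inv]
  -- the uniformisation `z ↦ ι⁻¹ (ψ' (u z))`
  set ψ : ℂ →+ (W.baseChange ℂ).toAffine.Point :=
    ι.symm.toAddMonoidHom.comp (D.uniformize.comp (AddMonoidHom.mulLeft (u : ℂ))) with hψ_def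
  have hψ : ∀ z, ψ z = ι.symm (D.uniformize ((u : ℂ) * z)) := fun z ↦ rfl
  -- numerator and denominator of `u`
  have hnum : ((u.num : ℤ) : ℂ) = (u : ℂ) * (u.den : ℂ) := by
    have h := Rat.den_mul_eq_num u
    have h' : ((u.den : ℚ) : ℂ) * ((u : ℚ) : ℂ) = ((u.num : ℚ) : ℂ) := by
      rw [← Rat.cast_mul, h]
    rw [mul_comm]
    simpa using h'.symm
  have hnum0 : u.num ≠ 0 := Rat.num_ne_zero.mpr hu
  refine ⟨{
    f := D.f
    isNewformOf := ⟨D.isNewformOf.1, fun n ↦ by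
      rw [D.isNewformOf.2 n, WeierstrassCurve.LFunction_smul]⟩
    L := L
    isNeronLattice := ?_
    uniformize := ψ
    ker_uniformize := ?_
    uniformize_surjective := ?_
    uniformize_spec := ?_
    c := (u.den : ℤ) * D.c
    smul_periodLattice_le := ?_
    deg := u.num.natAbs ^ 2 * D.deg
    deg_pos := Nat.mul_pos (pow_pos (Int.natAbs_pos.mpr hnum0) 2) D.deg_pos
    deg_spec := ?_ }, rfl, rfl⟩
  · -- `g₂(u⁻¹Λ') = u⁴ g₂(Λ') = c₄(W)/12`, `g₃(u⁻¹Λ') = u⁶ g₃(Λ') = c₆(W)/216`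
    obtain ⟨h₂, h₃⟩ := D.isNeronLattice
    constructor
    · rw [hL_def, PeriodPair.g₂_mulLeft, h₂, WeierstrassCurve.baseChange, WeierstrassCurve.map_c₄,
        WeierstrassCurve.variableChange_c₄, WeierstrassCurve.baseChange, WeierstrassCurve.map_c₄]
      simp only [map_mul, map_pow, Units.val_inv_eq_inv_val, map_inv₀, eq_ratCast, inv_pow,
        inv_inv]
      rw [← hu_def]
      field_simp
    · rw [hL_def, PeriodPair.g₃_mulLeft, h₃, WeierstrassCurve.baseChange, WeierstrassCurve.map_c₆,
        WeierstrassCurve.variableChange_c₆, WeierstrassCurve.baseChange, WeierstrassCurve.map_c₆]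
      simp only [map_mul, map_pow, Units.val_inv_eq_inv_val, map_inv₀, eq_ratCast, inv_pow,
        inv_inv]
      rw [← hu_def]
      field_simp
  · -- kernel `= u⁻¹ Λ'`
    ext z
    rw [SetLike.mem_coe, AddMonoidHom.mem_ker, hψ, AddEquiv.map_eq_zero_iff,
      D.uniformize_eq_zero_iff, SetLike.mem_coe, hmemL]
  · -- surjective
    intro P
    obtain ⟨w, hw⟩ := D.uniformize_surjective (ι P)
    refine ⟨(u : ℂ)⁻¹ * w, ?_⟩
    rw [hψ, ← mul_assoc, mul_inv_cancel₀ huC, one_mul, hw, AddEquiv.symm_apply_apply]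
  · -- the `℘`-normalisation
    intro z hz
    have hz' : (u : ℂ) * z ∉ D.L.lattice := fun h ↦ hz ((hmemL z).mpr h)
    obtain ⟨h', hspec⟩ := D.uniformize_spec ((u : ℂ) * z) hz'
    -- homogeneity of `℘`, `℘'`
    have hP : L.weierstrassP z = (u : ℂ) ^ 2 * D.L.weierstrassP ((u : ℂ) * z) := by
      have h := PeriodPair.weierstrassP_mulLeft (u : ℂ)⁻¹ huCi D.L ((u : ℂ) * z)
      rw [← mul_assoc, inv_mul_cancel₀ huC, one_mul, inv_pow, inv_inv] at h
      rw [hL_def, h]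
    have hP' : L.derivWeierstrassP z = (u : ℂ) ^ 3 * D.L.derivWeierstrassP ((u : ℂ) * z) := by
      have h := PeriodPair.derivWeierstrassP_mulLeft (u : ℂ)⁻¹ huCi D.L ((u : ℂ) * z)
      rw [← mul_assoc, inv_mul_cancel₀ huC, one_mul, inv_pow, inv_inv] at h
      rw [hL_def, h]
    -- the coefficients of `C • W` over `ℂ`
    have hb₂ : ((C • W).baseChange ℂ).b₂ =
        (u : ℂ)⁻¹ ^ 2 * ((W.baseChange ℂ).b₂ + 12 * (C.r : ℂ)) := by
      rw [hsmul, WeierstrassCurve.variableChange_b₂, hCcui, hCcr]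
    have ha₁ : ((C • W).baseChange ℂ).a₁ = (u : ℂ)⁻¹ * ((W.baseChange ℂ).a₁ + 2 * (C.s : ℂ)) := by
      rw [hsmul, WeierstrassCurve.variableChange_a₁, hCcui, hCcs]
    have ha₃ : ((C • W).baseChange ℂ).a₃ = (u : ℂ)⁻¹ ^ 3 *
        ((W.baseChange ℂ).a₃ + (C.r : ℂ) * (W.baseChange ℂ).a₁ + 2 * (C.t : ℂ)) := by
      rw [hsmul, WeierstrassCurve.variableChange_a₃, hCcui, hCcr, hCct]
    -- the new coordinates of the target point are the coordinates of `ψ'(uz)`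
    set X : ℂ := L.weierstrassP z - (W.baseChange ℂ).b₂ / 12 with hX
    set Y : ℂ := (L.derivWeierstrassP z - (W.baseChange ℂ).a₁ * (L.weierstrassP z -
      (W.baseChange ℂ).b₂ / 12) - (W.baseChange ℂ).a₃) / 2 with hY
    have hx : Cc.toX X = D.L.weierstrassP ((u : ℂ) * z) - ((C • W).baseChange ℂ).b₂ / 12 := by
      rw [WeierstrassCurve.VariableChange.toX_def, hCcui, hCcr, hX, hP, hb₂]
      field_simp
      ring
    have hy : Cc.toY X Y = (D.L.derivWeierstrassP ((u : ℂ) * z) -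
        ((C • W).baseChange ℂ).a₁ * (D.L.weierstrassP ((u : ℂ) * z) -
          ((C • W).baseChange ℂ).b₂ / 12) - ((C • W).baseChange ℂ).a₃) / 2 := by
      rw [WeierstrassCurve.VariableChange.toY_def, hCcui, hCcr, hCcs, hCct, hX, hY, hP, hP', hb₂,
        ha₁, ha₃]
      field_simp
      ring
    -- nonsingularity of the target point, transported back along the substitution
    have h₀ : (W.baseChange ℂ).toAffine.Nonsingular X Y := by
      rw [← WeierstrassCurve.VariableChange.nonsingular_iff (W.baseChange ℂ) Cc X Y, hx, hy,
        ← hsmul]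
      exact h'
    refine ⟨h₀, ?_⟩
    rw [hψ, AddEquiv.symm_apply_eq, hspec, hι_def,
      WeierstrassCurve.VariableChange.pointEquivBaseChange_some]
    simp only [← hCc_def, hx, hy]
  · -- `u · (q c') Λ_f = p c' Λ_f ⊆ p Λ' ⊆ Λ'`
    intro z hz
    rw [hmemL, Int.cast_mul, Int.cast_natCast, ← mul_assoc, ← mul_assoc, ← hnum, mul_assoc,
      ← zsmul_eq_mul]
    exact D.L.lattice.smul_mem u.num (D.smul_periodLattice_le z hz)
  · -- the fibre count: the new parametrisation is `ι⁻¹ ∘ [p] ∘ φ'`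
    have hφ : ∀ τ : ℍ, ψ ((((u.den : ℤ) * D.c : ℤ) : ℂ) * eichlerIntegral D.f τ) =
        ι.symm (u.num • D.φ τ) := fun τ ↦ by
      rw [hψ, Int.cast_mul, Int.cast_natCast, ← mul_assoc, ← mul_assoc, ← hnum, mul_assoc,
        ← zsmul_eq_mul, map_zsmul]
      rfl
    have hfin := finite_setOf_natCard_fibre_zsmul_ne D u.num hnum0
    refine (hfin.preimage ι.injective.injOn).subset fun P hP ↦ ?_
    simp only [Set.mem_preimage, Set.mem_setOf_eq]
    simp only [Set.mem_setOf_eq, hφ] at hP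
    convert hP using 4 with y
    refine exists_congr fun τ ↦ and_congr Iff.rfl ?_
    rw [AddEquiv.symm_apply_eq]

end Summit.ABC.ABC.Theorems.DefiniteRTControlPrime

end
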